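import Summits.CriticalPhenomena.PercolationContinuityZ3.Theorems.PercNearOneGluingNoHeavyLowerTailAntitheticPeel
import Summits.CriticalPhenomena.PercolationContinuityZ3.Theorems.PercNearOneGluingNoHeavyLowerTailAntitheticConesHanging
import HarnessLib

/-!
# `NoHeavyLowerTail` (stmt-CriticalPhenomena-4575) — antithetic cluster pairs: SINKS on cones with hanging trees, by PEELING
# (prim-hp-2 gen 36; MEMO-gen36 §3b/§6)

Support file (`--supports stmt-CriticalPhenomena-4575`, hull-port prover `prim-hp-2`, gen 36).  No definitions, no named facts, no sorries;
standard axioms.  First end-to-end use of the peeling meta-theorem (`…AntitheticPeel`): a BIC theorem for a class of graphs that is stable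
under "delete all edges at a vertex" is upgraded to the full constrained inequality `T_E(R,X) ≥ 0` — in particular to the antithetic BHK
inequality SC(E,X) — for every avoidance set `R` and every sink set `X`.

THE CLASS ("cones with hanging trees", hypotheses on `E` only): every vertex `x ≠ s` NOT adjacent to `s`
 (h1) hangs from a spoked vertex — some `y` with `sy ∈ E` lies on every walk of `G − s` from a neighbour of `s` to `x`, and
 (h2) lies behind a bridge — some pair `e` lies on every walk of `G` from `s` to `x` (so `x` is never joined to `s` in both colours).
Wheels / fans / cliques through `s` with pendant trees at arbitrary vertices are in the class.  Ingredients: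
* `Peel.tsum_nonneg_of_bic_family` — the meta-theorem for a peeling-closed FAMILY of edge sets (BIC on the family ⟹ `T ≥ 0` on it);
* `Peel.tsum_eq_of_never_both` — `R`-vertices that can never be doubly reached may be dropped from `R`;
* `Peel.not_both_of_bridge`, `Peel.eq_of_reachable_isolated` — vertices behind a bridge / isolated vertices are never doubly reached;
* `Antithetic.cone_hanging_tsum_nonneg` — `T_E(R,X) ≥ 0` for all `R ∌ s`, all `X`, on the class; `Antithetic.cone_hanging_sc_nonneg` — SC(E,X).
[cite: VandenbergHaggstromKahn2005, Thm. 1.3 (p. 6), §1 p. 3 (open cluster `C_s`)]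
-/

noncomputable section

namespace Summit.CriticalPhenomena.PercolationContinuityZ3.Theorems

open Literature.Probability.Percolation
open scoped Classical symmDiff

namespace Antithetic

namespace Peel

variable {V : Type*} [Fintype V]

/-- **Meta-theorem for a peeling-closed family.**  `P` a property of edge sets with `P E`, stable under deleting all pairs at a vertex `x ≠ s`;
if `BIC_{E'}(R') = T_{E'}(R',∅) ≥ 0` for every `E'` with `P E'` and every `R' ∌ s`, then `T_E(R,X) ≥ 0` for all `R ∌ s` and all `X`. [this work] -/
theorem tsum_nonneg_of_bic_family (F G : Set (Sym2 V) → ℝ) (s : V) (P : Set (Sym2 V) → Prop)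
    (hPeel : ∀ E' : Set (Sym2 V), P E' → ∀ x, x ≠ s → P (E' \ {e | x ∈ e}))
    (hBIC : ∀ E' : Set (Sym2 V), P E' → ∀ R : Set V, s ∉ R → 0 ≤ tsum F G E' s R ∅)
    (E : Set (Sym2 V)) (hE : P E) : ∀ (R X : Set V), s ∉ R → 0 ≤ tsum F G E s R X := by
  suffices H : ∀ n : ℕ, ∀ E' : Set (Sym2 V), P E' → ∀ R X : Set V, s ∉ R →
      E'.ncard * (Fintype.card V + 1) + X.ncard ≤ n → 0 ≤ tsum F G E' s R X from
    fun R X hR => H _ E hE R X hR le_rfl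
  intro n
  induction n with
  | zero =>
    intro E' hE' R X hR hμ
    have hX : X = ∅ := by
      have : X.ncard = 0 := by omega
      exact (Set.ncard_eq_zero (Set.toFinite X)).1 this
    subst hX
    exact hBIC E' hE' R hR
  | succ n ih =>
    intro E' hE' R X hR hμ
    by_cases hsX : s ∈ X
    · rw [tsum_eq_zero_of_mem_X F G E' s R hsX]
    by_cases hXe : X = ∅
    · subst hXe; exact hBIC E' hE' R hR
    obtain ⟨x, hxX⟩ := Set.nonempty_iff_ne_empty.2 hXe
    have hxs : x ≠ s := fun h => hsX (h ▸ hxX)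
    have hpeel := peel_identity F G E' s x hxs R X hxX
    set N := Finset.univ.filter fun u => s(x, u) ∈ E' ∧ u ≠ x with hN
    have hpos : (0 : ℝ) < (2 : ℝ) ^ N.card := pow_pos two_pos _
    suffices hsum : 0 ≤ ∑ A ∈ N.powerset, tsum F G (E' \ {e | x ∈ e}) s (R ∪ ↑(N \ A)) ((X \ {x}) ∪ ↑A) by
      rw [← hpeel] at hsum
      exact le_of_mul_le_mul_left (by rw [mul_zero]; exact hsum) hpos
    refine Finset.sum_nonneg fun A hA => ?_
    by_cases hsR : s ∈ R ∪ ↑(N \ A)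
    · rw [tsum_eq_zero_of_mem_R F G _ s _ hsR]
    refine ih (E' \ {e | x ∈ e}) (hPeel E' hE' x hxs) _ _ hsR ?_
    have hE'' : E' \ {e | x ∈ e} ⊆ E' := fun e he => he.1
    have hXfin := Set.toFinite X
    have hX' : ((X \ {x}) ∪ ↑A).ncard ≤ Fintype.card V := by
      rw [← Nat.card_eq_fintype_card, ← Set.ncard_univ]
      exact Set.ncard_le_ncard (Set.subset_univ _)
    have hXx : (X \ {x}).ncard + 1 = X.ncard := Set.ncard_sdiff_singleton_add_one hxX hXfin
    by_cases hNe : N = ∅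
    · have hA0 : A = ∅ := Finset.subset_empty.1 (hNe ▸ Finset.mem_powerset.1 hA)
      subst hA0
      have h1 : (E' \ {e | x ∈ e}).ncard ≤ E'.ncard := Set.ncard_le_ncard hE'' (Set.toFinite E')
      have h2 : ((X \ {x}) ∪ ↑(∅ : Finset V)).ncard = (X \ {x}).ncard := by simp
      rw [h2]
      have := Nat.mul_le_mul_right (Fintype.card V + 1) h1
      omega
    · obtain ⟨u, hu⟩ := Finset.nonempty_iff_ne_empty.2 hNe
      rw [hN, Finset.mem_filter] at hu
      have hlt : (E' \ {e | x ∈ e}).ncard < E'.ncard :=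
        Set.ncard_lt_ncard ⟨hE'', fun h => (h hu.2.1).2 (Sym2.mem_mk_left x u)⟩ (Set.toFinite E')
      have := Nat.mul_le_mul_right (Fintype.card V + 1) (Nat.succ_le_of_lt hlt)
      rw [Nat.succ_mul] at this
      omega

/-- **Irrelevant avoidance vertices**: if every vertex of `R` outside `D` is never joined to `s` in both colours (for the edge set `E`), then
`T_E(R,X) = T_E(R ∩ D, X)`. [this work] -/
theorem tsum_eq_of_never_both (F G : Set (Sym2 V) → ℝ) (E : Set (Sym2 V)) (s : V) (R D X : Set V)
    (hD : ∀ r ∈ R, r ∉ D → ∀ ω : Set (Sym2 V), ¬ ((openGraph (ω ∩ E)).Reachable s r ∧ (openGraph (ωᶜ ∩ E)).Reachable s r)) :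
    tsum F G E s R X = tsum F G E s (R ∩ D) X := by
  unfold tsum
  have : tset E s R X = tset E s (R ∩ D) X := by
    ext ω
    rw [mem_tset, mem_tset]
    constructor
    · rintro ⟨hR, hX⟩; exact ⟨fun r hr => hR r hr.1, hX⟩
    · rintro ⟨hR, hX⟩
      refine ⟨fun r hr => ?_, hX⟩
      by_cases hrD : r ∈ D
      · exact hR r ⟨hr, hrD⟩
      · exact hD r hr hrD ω
  rw [this]

omit [Fintype V] in
/-- An isolated vertex is reachable only from itself. [folklore] -/
theorem eq_of_reachable_isolated (η : Set (Sym2 V)) {u y : V} (hy : ∀ e ∈ η, y ∈ e → e.IsDiag) (h : (openGraph η).Reachable u y) :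
    u = y := by
  obtain ⟨p⟩ := h
  cases hp : p.reverse with
  | nil => rfl
  | cons hadj _ =>
    rw [openGraph_adj] at hadj
    exact absurd (hy _ hadj.1 (Sym2.mem_mk_left _ _)) (by rw [Sym2.mk_isDiag_iff]; exact hadj.2)

omit [Fintype V] in
/-- **Behind a bridge ⟹ never doubly reached**: if one pair `e` lies on every walk from `s` to `x` in the graph of `E`, then for no colouring is `x`
joined to `s` both in `ω ∩ E'` and in `ωᶜ ∩ E'`, for any `E' ⊆ E`. [this work] -/
theorem not_both_of_bridge (E E' : Set (Sym2 V)) (hE' : E' ⊆ E) (s x : V) (e : Sym2 V) (he : ∀ p : (openGraph E).Walk s x, e ∈ p.edges)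
    (ω : Set (Sym2 V)) : ¬ ((openGraph (ω ∩ E')).Reachable s x ∧ (openGraph (ωᶜ ∩ E')).Reachable s x) := by
  rintro ⟨⟨p⟩, ⟨q⟩⟩
  have hp : ∀ e', e' ∈ p.edges → e' ∈ (openGraph E).edgeSet := fun e' he' => by
    have := p.edges_subset_edgeSet he'
    rw [openGraph, SimpleGraph.edgeSet_fromEdgeSet] at this ⊢
    exact ⟨hE' this.1.2, this.2⟩
  have hq : ∀ e', e' ∈ q.edges → e' ∈ (openGraph E).edgeSet := fun e' he' => by
    have := q.edges_subset_edgeSet he'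
    rw [openGraph, SimpleGraph.edgeSet_fromEdgeSet] at this ⊢
    exact ⟨hE' this.1.2, this.2⟩
  have h1 := he (p.transfer _ hp)
  have h2 := he (q.transfer _ hq)
  rw [SimpleGraph.Walk.edges_transfer] at h1 h2
  have h1' := p.edges_subset_edgeSet h1
  have h2' := q.edges_subset_edgeSet h2
  rw [openGraph, SimpleGraph.edgeSet_fromEdgeSet] at h1' h2'
  exact h2'.1.1 h1'.1.1

end Peel

section HangingSinks

variable {V : Type*} [Fintype V]

/-- **Cones with hanging trees: `T_E(R,X) ≥ 0` for every `R ∌ s` and every sink set `X`** (prim-hp-2 gen 36).  Hypotheses (on `E` only): every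
vertex `x ≠ s` with `sx ∉ E` (h1) hangs from a spoked vertex and (h2) lies behind a bridge.  Proof: the family `E ∖ {pairs meeting Y}` (`Y ∌ s`) is
peeling-closed; on it BIC holds for every `R` (drop the never-doubly-reached vertices of `R` — isolated or behind a bridge — and apply
`cone_hanging_bic_nonneg`); conclude by `Peel.tsum_nonneg_of_bic_family`. [this work] -/
theorem cone_hanging_tsum_nonneg (F G : Set (Sym2 V) → ℝ) (hF : Monotone F) (hG : Monotone G) (E : Set (Sym2 V)) (s : V)
    (hhang : ∀ x, x ≠ s → s(s, x) ∉ E →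
      ∃ y, s(s, y) ∈ E ∧ ∀ w, s(s, w) ∈ E → ∀ p : (openGraph {e | e ∈ E ∧ s ∉ e}).Walk w x, y ∈ p.support)
    (hbr : ∀ x, x ≠ s → s(s, x) ∉ E → ∃ e, ∀ p : (openGraph E).Walk s x, e ∈ p.edges)
    (R X : Set V) (hRs : s ∉ R) : 0 ≤ Peel.tsum F G E s R X := by
  -- the peeling-closed family
  let P : Set (Sym2 V) → Prop := fun E' => ∃ Y : Set V, s ∉ Y ∧ E' = E \ {e | ∃ y ∈ Y, y ∈ e}
  have hPE : P E := ⟨∅, fun h => h, by ext e; simp⟩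
  have hPeel : ∀ E', P E' → ∀ x, x ≠ s → P (E' \ {e | x ∈ e}) := by
    rintro E' ⟨Y, hsY, rfl⟩ x hxs
    refine ⟨Y ∪ {x}, fun h => h.elim hsY (fun h => hxs.symm h), ?_⟩
    ext e
    simp only [Set.mem_sdiff, Set.mem_setOf_eq, Set.mem_union, Set.mem_singleton_iff]
    constructor
    · rintro ⟨⟨hE, hY⟩, hx⟩
      refine ⟨hE, ?_⟩
      rintro ⟨y, hy | rfl, hye⟩
      · exact hY ⟨y, hy, hye⟩
      · exact hx hye
    · rintro ⟨hE, hY⟩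
      exact ⟨⟨hE, fun ⟨y, hy, hye⟩ => hY ⟨y, Or.inl hy, hye⟩⟩, fun hx => hY ⟨x, Or.inr rfl, hx⟩⟩
  refine Peel.tsum_nonneg_of_bic_family F G s P hPeel ?_ E hPE R X hRs
  -- BIC on the family
  rintro E' ⟨Y, hsY, rfl⟩ R' hR'
  set EY := E \ {e | ∃ y ∈ Y, y ∈ e} with hEY
  have hsub : EY ⊆ E := fun e he => he.1
  -- spoked vertices of EY
  set D : Set V := {u | s(s, u) ∈ EY} with hD
  -- vertices outside D are never doubly reached in EY
  have hnever : ∀ r ∈ R', r ∉ D → ∀ ω : Set (Sym2 V),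
      ¬ ((openGraph (ω ∩ EY)).Reachable s r ∧ (openGraph (ωᶜ ∩ EY)).Reachable s r) := by
    intro r hr hrD ω
    have hrs : r ≠ s := fun h => hR' (h ▸ hr)
    by_cases hrY : r ∈ Y
    · -- r is isolated in EY
      rintro ⟨hred, -⟩
      have hiso : ∀ e ∈ ω ∩ EY, r ∈ e → e.IsDiag := fun e he hre => absurd ⟨r, hrY, hre⟩ he.2.2
      exact hrs (Peel.eq_of_reachable_isolated _ hiso hred).symm
    · -- r is spoke-less in E: behind a bridge
      have hrE : s(s, r) ∉ E := fun h => hrD ⟨h, fun ⟨y, hy, hye⟩ => by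
        rcases Sym2.mem_iff.1 hye with rfl | rfl
        · exact hsY hy
        · exact hrY hy⟩
      obtain ⟨e, he⟩ := hbr r hrs hrE
      exact Peel.not_both_of_bridge E EY hsub s r e he ω
  rw [Peel.tsum_eq_of_never_both F G EY s R' D ∅ hnever]
  -- now R' ∩ D ⊆ N_{EY}(s): apply the hanging-cone theorem on EY
  have hRN : ∀ u ∈ R' ∩ D, s(s, u) ∈ EY := fun u hu => hu.2
  have hRs2 : s ∉ R' ∩ D := fun h => hR' h.1
  have hhangY : ∀ x, x ≠ s → s(s, x) ∉ EY → (∃ u ∈ R' ∩ D, (openGraph {e | e ∈ EY ∧ s ∉ e}).Reachable u x) →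
      ∃ y, s(s, y) ∈ EY ∧ ∀ w, s(s, w) ∈ EY → ∀ p : (openGraph {e | e ∈ EY ∧ s ∉ e}).Walk w x, y ∈ p.support := by
    rintro x hxs hxEY ⟨u, hu, hux⟩
    -- x ∉ Y (else isolated and u = x would be spoked), and x is spoke-less in E
    have hsub' : {e | e ∈ EY ∧ s ∉ e} ⊆ {e | e ∈ E ∧ s ∉ e} := fun e he => ⟨he.1.1, he.2⟩
    have hxY : x ∉ Y := by
      intro hxY
      have hiso : ∀ e ∈ {e | e ∈ EY ∧ s ∉ e}, x ∈ e → e.IsDiag := fun e he hxe => absurd ⟨x, hxY, hxe⟩ he.1.2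
      have := Peel.eq_of_reachable_isolated _ hiso hux
      subst this
      exact absurd ⟨u, hxY, Sym2.mem_mk_right s u⟩ hu.2.2
    have hxE : s(s, x) ∉ E := fun h => hxEY ⟨h, fun ⟨y, hy, hye⟩ => by
      rcases Sym2.mem_iff.1 hye with rfl | rfl
      · exact hsY hy
      · exact hxY hy⟩
    obtain ⟨y, hyE, hy⟩ := hhang x hxs hxE
    -- y is on the walk from u, hence not isolated, hence y ∉ Y
    obtain ⟨p⟩ := hux
    have hyp : y ∈ p.support := by
      have := hy u (hsub hu.2) (p.transfer (openGraph {e | e ∈ E ∧ s ∉ e}) fun e he => by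
        have := p.edges_subset_edgeSet he
        rw [openGraph, SimpleGraph.edgeSet_fromEdgeSet] at this ⊢
        exact ⟨hsub' this.1, this.2⟩)
      rwa [SimpleGraph.Walk.support_transfer] at this
    have hyY : y ∉ Y := by
      intro hyY
      obtain ⟨q, -, -⟩ := SimpleGraph.Walk.mem_support_iff_exists_append.1 hyp
      have hiso : ∀ e ∈ {e | e ∈ EY ∧ s ∉ e}, y ∈ e → e.IsDiag := fun e he hye => absurd ⟨y, hyY, hye⟩ he.1.2
      have := Peel.eq_of_reachable_isolated _ hiso ⟨q⟩
      subst this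
      exact absurd ⟨u, hyY, Sym2.mem_mk_right s u⟩ hu.2.2
    refine ⟨y, ⟨hyE, fun ⟨z, hz, hze⟩ => ?_⟩, fun w hw q => ?_⟩
    · rcases Sym2.mem_iff.1 hze with rfl | rfl
      · exact hsY hz
      · exact hyY hz
    · have := hy w (hsub hw) (q.transfer (openGraph {e | e ∈ E ∧ s ∉ e}) fun e he => by
        have := q.edges_subset_edgeSet he
        rw [openGraph, SimpleGraph.edgeSet_fromEdgeSet] at this ⊢
        exact ⟨hsub' this.1, this.2⟩)
      rwa [SimpleGraph.Walk.support_transfer] at this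
  have h := cone_hanging_bic_nonneg EY s (R' ∩ D) hRs2 hRN hhangY hF hG
  have hset : Peel.tset EY s (R' ∩ D) ∅ = Finset.univ.filter (fun ω : Set (Sym2 V) =>
      ∀ r ∈ R' ∩ D, ¬ ((openGraph (ω ∩ EY)).Reachable s r ∧ (openGraph (ωᶜ ∩ EY)).Reachable s r)) := by
    ext ω
    simp [Peel.mem_tset]
  unfold Peel.tsum Peel.delta
  rw [hset]
  convert h using 2
  ext ω
  simp only [Finset.mem_filter, Finset.mem_univ, true_and]

/-- **The antithetic BHK inequality with sinks on cones with hanging trees**: under (h1), (h2), for every sink set `X`,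
`0 ≤ Σ_{ω : no x ∈ X joined to s in ω∩E or ωᶜ∩E} (F(C_s(ω∩E)) − F(C_s(ωᶜ∩E)))(G(C_s(ω∩E)) − G(C_s(ωᶜ∩E)))`. [this work] -/
theorem cone_hanging_sc_nonneg (F G : Set (Sym2 V) → ℝ) (hF : Monotone F) (hG : Monotone G) (E : Set (Sym2 V)) (s : V)
    (hhang : ∀ x, x ≠ s → s(s, x) ∉ E →
      ∃ y, s(s, y) ∈ E ∧ ∀ w, s(s, w) ∈ E → ∀ p : (openGraph {e | e ∈ E ∧ s ∉ e}).Walk w x, y ∈ p.support)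
    (hbr : ∀ x, x ≠ s → s(s, x) ∉ E → ∃ e, ∀ p : (openGraph E).Walk s x, e ∈ p.edges) (X : Set V) :
    0 ≤ ∑ ω ∈ Finset.univ.filter (fun ω : Set (Sym2 V) =>
        ∀ x ∈ X, ¬ (openGraph (ω ∩ E)).Reachable s x ∧ ¬ (openGraph (ωᶜ ∩ E)).Reachable s x),
      (F (openEdgeCluster (ω ∩ E) s) - F (openEdgeCluster (ωᶜ ∩ E) s)) *
        (G (openEdgeCluster (ω ∩ E) s) - G (openEdgeCluster (ωᶜ ∩ E) s)) := by
  have h := cone_hanging_tsum_nonneg F G hF hG E s hhang hbr ∅ X (Set.notMem_empty s)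
  have hset : Peel.tset E s ∅ X = Finset.univ.filter (fun ω : Set (Sym2 V) =>
      ∀ x ∈ X, ¬ (openGraph (ω ∩ E)).Reachable s x ∧ ¬ (openGraph (ωᶜ ∩ E)).Reachable s x) := by
    ext ω
    simp [Peel.mem_tset]
  unfold Peel.tsum at h
  rw [hset] at h
  exact h

end HangingSinks

end Antithetic

end Summit.CriticalPhenomena.PercolationContinuityZ3.Theorems
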